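import Mathlib
import Literature.Combinatorics.Additive.TripleProductProperty
import Literature.Computability.AlgebraicComplexity.GroupTheoreticMatMulThmBProofs
import Literature.Computability.AlgebraicComplexity.PrattTrapezoidValSTPP
import Summits.MatrixMultiplication.MatrixMultiplication.Theorems.GroupTheoreticSTPPCThesisFramePackingZMod
import Summits.MatrixMultiplication.MatrixMultiplication.Theorems.GroupTheoreticSTPPCThesisProp52PairMaximal

/-!
# Frame packings in `(ℤ/n)³`, II: an STPP family with two frame triples has no third member (all `n ≥ 4`)

Support file for route `MatrixMultiplication/GroupTheoreticSTPP` (target `CThesis`, stmt-MatrixMultiplication-0593),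
cell `mm-stpp` (D-0046), KILL memo §6 T1/T3 for EVERY modulus `n ≥ 4`.  Sequel of
`GroupTheoreticSTPPCThesisFramePackingZMod.lean` (`frame_pair_classification_four`: a frame triple STPP-compatible
with the axes triple has its vectors on the axes of one of the two cyclic relabelings) and of
`GroupTheoreticSTPPCThesisProp52PairMaximal.lean` (the CKSU Prop. 5.2 pair `(P₀,P₁,P₂), (P₁,P₂,P₀)` admits no
third triple of non-empty sets, `n ≥ 3`).  A *frame triple* is `((ℤ/n∖0)·v₀, (ℤ/n∖0)·v₁, (ℤ/n∖0)·v₂)` for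
the columns `vₖ` of an invertible matrix (`IsUnit det`) — the image of the axes triple under `GL₃(ℤ/n)`,
the census convention of both engines.

* `frame_pair_sets`, `member_is_rotation` — set form of the classification: inside any STPP family a frame
  triple next to the axes triple IS `(P₁,P₂,P₀)` or `(P₂,P₀,P₁)` (invertibility makes coordinates units);
* `card_le_two_of_axes_rot(2)` — an STPP family of triples of non-empty sets containing the axes triple
  and `rot` (resp. `rot²`, after the coordinate rotation `x ↦ x ∘ (finRotate 3)⁻¹`) has `≤ 2` members;
* `card_le_two_of_two_frames` — **main theorem: an STPP family in `(ℤ/n)³`, `n ≥ 4`, all of whose triples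
  consist of non-empty sets and two of whose members are frame triples, has exactly two members** (change
  of basis by an inverse frame matrix, `addSimultaneousTPP_image_of_reflect`); so a family of `k ≥ 3`
  non-degenerate triples contains AT MOST ONE frame triple;
* `card_le_two_of_frames(_prime)` — every STPP family of frame triples has `≤ 2` members:
  `k_max^{frame}(n) = 2` for all `n ≥ 4` (attained by CKSU Prop. 5.2) = census clause K-F3(a) as a
  theorem, composite moduli included (`n = 3` rests on the engines' exhaustive census).

WHAT THIS IS NOT: statements about families containing frame triples; nothing about packings of arbitrary
`(n−1, n−1, n−1)` sets without a frame member (CENSUS-PLAN F3b) or about `ω`.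

## References
* H. Cohn, R. Kleinberg, B. Szegedy, C. Umans, FOCS 2005, Def. 5.1, Prop. 5.2.
-/

-- single-conjunct summit: the mandated namespace repeats `MatrixMultiplication`.
set_option linter.dupNamespace false

namespace Summit.MatrixMultiplication.MatrixMultiplication.Theorems

namespace FramePackingZMod

open Finset Literature.Combinatorics.Additive Literature.Computability.AlgebraicComplexity

variable {n : ℕ}

/-! ### Set form of the classification -/

section Sets

variable {A B C : Fin 2 → Finset (Fin 3 → ZMod n)} {v₀ v₁ v₂ : Fin 3 → ZMod n}

/-- The non-zero multiples of a vector on the axis `k` whose `k`-th coordinate is a unit form the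
punctured axis `k`. [folklore] -/
theorem mem_pline_axis_iff {v : Fin 3 → ZMod n} {k : Fin 3} (hvk : IsUnit (v k))
    (hv : ∀ j, j ≠ k → v j = 0) (x : Fin 3 → ZMod n) :
    (∃ c : ZMod n, c ≠ 0 ∧ x = c • v) ↔ (x k ≠ 0 ∧ ∀ j, j ≠ k → x j = 0) := by
  obtain ⟨u, hu⟩ := hvk
  constructor
  · rintro ⟨c, hc, rfl⟩
    refine ⟨fun h => hc ?_, fun j hj => by simp [Pi.smul_apply, smul_eq_mul, hv j hj]⟩
    rw [Pi.smul_apply, smul_eq_mul, ← hu] at h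
    simpa using congr_arg (· * ((u⁻¹ : (ZMod n)ˣ) : ZMod n)) h
  · rintro ⟨hxk, hx⟩
    refine ⟨x k * ((u⁻¹ : (ZMod n)ˣ) : ZMod n), fun h => hxk ?_, ?_⟩
    · simpa using congr_arg (· * (u : ZMod n)) h
    · funext j
      by_cases hj : j = k
      · subst hj
        rw [Pi.smul_apply, smul_eq_mul, ← hu, mul_assoc, Units.inv_mul, mul_one]
      · rw [Pi.smul_apply, smul_eq_mul, hv j hj, hx j hj, mul_zero]

/-- **Frame pairs, set form** (`n ≥ 4`, invertible frame matrix): the second triple IS, by membership,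
`(P₁, P₂, P₀)` or `(P₂, P₀, P₁)`. [cite: CohnKleinbergSzegedyUmans2005, Def. 5.1 and Prop. 5.2] -/
theorem frame_pair_sets (hn : 4 ≤ n)
    (hA0 : ∀ x, x ∈ A 0 ↔ x 0 ≠ 0 ∧ ∀ j, j ≠ 0 → x j = 0)
    (hB0 : ∀ x, x ∈ B 0 ↔ x 1 ≠ 0 ∧ ∀ j, j ≠ 1 → x j = 0)
    (hC0 : ∀ x, x ∈ C 0 ↔ x 2 ≠ 0 ∧ ∀ j, j ≠ 2 → x j = 0)
    (hA1 : ∀ x, x ∈ A 1 ↔ ∃ c : ZMod n, c ≠ 0 ∧ x = c • v₀)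
    (hB1 : ∀ x, x ∈ B 1 ↔ ∃ c : ZMod n, c ≠ 0 ∧ x = c • v₁)
    (hC1 : ∀ x, x ∈ C 1 ↔ ∃ c : ZMod n, c ≠ 0 ∧ x = c • v₂)
    (hdet : IsUnit (Matrix.det (Matrix.of ![v₀, v₁, v₂])))
    (hS : AddSimultaneousTPP A B C) :
    ((∀ x, x ∈ A 1 ↔ x 1 ≠ 0 ∧ ∀ j, j ≠ 1 → x j = 0) ∧ (∀ x, x ∈ B 1 ↔ x 2 ≠ 0 ∧ ∀ j, j ≠ 2 → x j = 0) ∧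
        (∀ x, x ∈ C 1 ↔ x 0 ≠ 0 ∧ ∀ j, j ≠ 0 → x j = 0)) ∨
      ((∀ x, x ∈ A 1 ↔ x 2 ≠ 0 ∧ ∀ j, j ≠ 2 → x j = 0) ∧ (∀ x, x ∈ B 1 ↔ x 0 ≠ 0 ∧ ∀ j, j ≠ 0 → x j = 0) ∧
        (∀ x, x ∈ C 1 ↔ x 1 ≠ 0 ∧ ∀ j, j ≠ 1 → x j = 0)) := by
  haveI : Fact (1 < n) := ⟨by omega⟩
  have hd : Matrix.det (Matrix.of ![v₀, v₁, v₂]) =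
      v₀ 0 * v₁ 1 * v₂ 2 - v₀ 0 * v₁ 2 * v₂ 1 - v₀ 1 * v₁ 0 * v₂ 2 + v₀ 1 * v₁ 2 * v₂ 0 +
        v₀ 2 * v₁ 0 * v₂ 1 - v₀ 2 * v₁ 1 * v₂ 0 := by
    rw [Matrix.det_fin_three]; rfl
  have hcl := frame_pair_classification_four hn hA0 hB0 hC0 hA1 hB1 hC1 hdet.ne_zero hS
  -- from the vanishing pattern and the unit determinant to the axis description
  have axis : ∀ (v : Fin 3 → ZMod n) (k : Fin 3), (∀ j, j ≠ k → v j = 0) → IsUnit (v k) →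
      ∀ (X : Finset (Fin 3 → ZMod n)), (∀ x, x ∈ X ↔ ∃ c : ZMod n, c ≠ 0 ∧ x = c • v) →
        ∀ x, x ∈ X ↔ x k ≠ 0 ∧ ∀ j, j ≠ k → x j = 0 := by
    intro v k hv hvk X hX x
    rw [hX x]
    exact mem_pline_axis_iff hvk hv x
  rcases hcl with ⟨h00, h02, h10, h11, h21, h22⟩ | ⟨h00, h01, h11, h12, h20, h22⟩
  · -- rot: v₀ ∥ e₁, v₁ ∥ e₂, v₂ ∥ e₀; `det = v₀1 v₁2 v₂0`
    have hu : IsUnit (v₀ 1 * v₁ 2 * v₂ 0) := by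
      have e : Matrix.det (Matrix.of ![v₀, v₁, v₂]) = v₀ 1 * v₁ 2 * v₂ 0 := by
        rw [hd, h00, h02, h10, h11, h21, h22]; ring
      rw [← e]; exact hdet
    refine Or.inl ⟨axis v₀ 1 (fun j hj => ?_) (isUnit_of_mul_isUnit_left (isUnit_of_mul_isUnit_left hu))
      _ hA1, axis v₁ 2 (fun j hj => ?_) (isUnit_of_mul_isUnit_right (isUnit_of_mul_isUnit_left hu)) _
      hB1, axis v₂ 0 (fun j hj => ?_) (isUnit_of_mul_isUnit_right hu) _ hC1⟩
    · fin_cases j <;> first | exact absurd rfl hj | assumption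
    · fin_cases j <;> first | exact absurd rfl hj | assumption
    · fin_cases j <;> first | exact absurd rfl hj | assumption
  · -- rot²: v₀ ∥ e₂, v₁ ∥ e₀, v₂ ∥ e₁; `det = v₀2 v₁0 v₂1`
    have hu : IsUnit (v₀ 2 * v₁ 0 * v₂ 1) := by
      have e : Matrix.det (Matrix.of ![v₀, v₁, v₂]) = v₀ 2 * v₁ 0 * v₂ 1 := by
        rw [hd, h00, h01, h11, h12, h20, h22]; ring
      rw [← e]; exact hdet
    refine Or.inr ⟨axis v₀ 2 (fun j hj => ?_) (isUnit_of_mul_isUnit_left (isUnit_of_mul_isUnit_left hu))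
      _ hA1, axis v₁ 0 (fun j hj => ?_) (isUnit_of_mul_isUnit_right (isUnit_of_mul_isUnit_left hu)) _
      hB1, axis v₂ 1 (fun j hj => ?_) (isUnit_of_mul_isUnit_right hu) _ hC1⟩
    · fin_cases j <;> first | exact absurd rfl hj | assumption
    · fin_cases j <;> first | exact absurd rfl hj | assumption
    · fin_cases j <;> first | exact absurd rfl hj | assumption

end Sets

/-! ### Inside an arbitrary STPP family -/

section Family

variable {ι : Type} {A' B' C' : ι → Finset (Fin 3 → ZMod n)}

/-- **Every frame member is a cyclic relabeling of the axes member (set form), inside any STPP family**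
(restrict to the two-member sub-family, `AddSimultaneousTPP.comp`). [cite: CohnKleinbergSzegedyUmans2005, Def. 5.1] -/
theorem member_is_rotation (hn : 4 ≤ n) (hS : AddSimultaneousTPP A' B' C') {i₀ i : ι} (hi : i₀ ≠ i)
    (hA0 : ∀ x, x ∈ A' i₀ ↔ x 0 ≠ 0 ∧ ∀ j, j ≠ 0 → x j = 0)
    (hB0 : ∀ x, x ∈ B' i₀ ↔ x 1 ≠ 0 ∧ ∀ j, j ≠ 1 → x j = 0)
    (hC0 : ∀ x, x ∈ C' i₀ ↔ x 2 ≠ 0 ∧ ∀ j, j ≠ 2 → x j = 0)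
    {v₀ v₁ v₂ : Fin 3 → ZMod n} (hdet : IsUnit (Matrix.det (Matrix.of ![v₀, v₁, v₂])))
    (hAi : ∀ x, x ∈ A' i ↔ ∃ c : ZMod n, c ≠ 0 ∧ x = c • v₀)
    (hBi : ∀ x, x ∈ B' i ↔ ∃ c : ZMod n, c ≠ 0 ∧ x = c • v₁)
    (hCi : ∀ x, x ∈ C' i ↔ ∃ c : ZMod n, c ≠ 0 ∧ x = c • v₂) :
    ((∀ x, x ∈ A' i ↔ x 1 ≠ 0 ∧ ∀ j, j ≠ 1 → x j = 0) ∧ (∀ x, x ∈ B' i ↔ x 2 ≠ 0 ∧ ∀ j, j ≠ 2 → x j = 0) ∧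
        (∀ x, x ∈ C' i ↔ x 0 ≠ 0 ∧ ∀ j, j ≠ 0 → x j = 0)) ∨
      ((∀ x, x ∈ A' i ↔ x 2 ≠ 0 ∧ ∀ j, j ≠ 2 → x j = 0) ∧ (∀ x, x ∈ B' i ↔ x 0 ≠ 0 ∧ ∀ j, j ≠ 0 → x j = 0) ∧
        (∀ x, x ∈ C' i ↔ x 1 ≠ 0 ∧ ∀ j, j ≠ 1 → x j = 0)) := by
  have he : Function.Injective ![i₀, i] := by
    intro x y h
    fin_cases x <;> fin_cases y
    · rfl
    · exact absurd h hi
    · exact absurd h.symm hi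
    · rfl
  exact frame_pair_sets (A := A' ∘ ![i₀, i]) (B := B' ∘ ![i₀, i]) (C := C' ∘ ![i₀, i]) hn
    hA0 hB0 hC0 hAi hBi hCi hdet (hS.comp he)

/-- A punctured axis `P_k` under the coordinate permutation `x ↦ x ∘ σ` is the punctured axis `P_{σ⁻¹ k}`.
[folklore] -/
theorem mem_image_comp_equiv_iff (σ : Equiv.Perm (Fin 3)) {X : Finset (Fin 3 → ZMod n)} {k : Fin 3}
    (hX : ∀ x, x ∈ X ↔ x k ≠ 0 ∧ ∀ j, j ≠ k → x j = 0) (y : Fin 3 → ZMod n) :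
    y ∈ X.image (fun x => x ∘ σ) ↔ y (σ.symm k) ≠ 0 ∧ ∀ j, j ≠ σ.symm k → y j = 0 := by
  constructor
  · intro hy
    obtain ⟨x, hx, rfl⟩ := Finset.mem_image.1 hy
    obtain ⟨hk, hj⟩ := (hX x).1 hx
    refine ⟨by simpa using hk, fun j hjk => ?_⟩
    simp only [Function.comp_apply]
    apply hj
    intro h
    apply hjk
    rw [← h, Equiv.symm_apply_apply]
  · rintro ⟨hk, hj⟩
    refine Finset.mem_image.2 ⟨y ∘ σ.symm, (hX _).2 ⟨hk, fun j hjk => ?_⟩, ?_⟩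
    · simp only [Function.comp_apply]
      apply hj
      intro h
      exact hjk (σ.symm.injective h)
    · funext i
      simp

/-- A third index beside `i₀ ≠ i₁` when `Fintype.card ι > 2`, with the injective enumeration
`![i₀, i₁, i₂]`. [folklore] -/
theorem exists_third [Fintype ι] [DecidableEq ι] {i₀ i₁ : ι} (h01 : i₀ ≠ i₁) (hlt : 2 < Fintype.card ι) :
    ∃ i₂, Function.Injective ![i₀, i₁, i₂] := by
  have hcard : 0 < ((Finset.univ.erase i₀).erase i₁).card := by
    rw [Finset.card_erase_of_mem (Finset.mem_erase.2 ⟨h01.symm, Finset.mem_univ _⟩),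
      Finset.card_erase_of_mem (Finset.mem_univ _), Finset.card_univ]
    omega
  obtain ⟨i₂, hi₂⟩ := Finset.card_pos.1 hcard
  have h21 : i₂ ≠ i₁ := (Finset.mem_erase.1 hi₂).1
  have h20 : i₂ ≠ i₀ := (Finset.mem_erase.1 (Finset.mem_erase.1 hi₂).2).1
  refine ⟨i₂, fun x y h => ?_⟩
  fin_cases x <;> fin_cases y
  · rfl
  · exact absurd h h01
  · exact absurd h h20.symm
  · exact absurd h.symm h01
  · rfl
  · exact absurd h h21.symm
  · exact absurd h.symm h20.symm
  · exact absurd h.symm h21.symm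
  · rfl

/-- **Normalized form, case `rot`** (`n ≥ 3`): an STPP family of triples of non-empty sets containing the
axes triple `(P₀,P₁,P₂)` at `i₀` and `(P₁,P₂,P₀)` at `i₁ ≠ i₀` has at most two members
(`Prop52Maximal.prop52_pair_maximal`). [cite: CohnKleinbergSzegedyUmans2005, Def. 5.1 and Prop. 5.2] -/
theorem card_le_two_of_axes_rot [Fintype ι] [DecidableEq ι] (hn : 3 ≤ n)
    (hS : AddSimultaneousTPP A' B' C') {i₀ i₁ : ι} (h01 : i₀ ≠ i₁)
    (hA0 : ∀ x, x ∈ A' i₀ ↔ x 0 ≠ 0 ∧ ∀ j, j ≠ 0 → x j = 0)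
    (hB0 : ∀ x, x ∈ B' i₀ ↔ x 1 ≠ 0 ∧ ∀ j, j ≠ 1 → x j = 0)
    (hC0 : ∀ x, x ∈ C' i₀ ↔ x 2 ≠ 0 ∧ ∀ j, j ≠ 2 → x j = 0)
    (hA1 : ∀ x, x ∈ A' i₁ ↔ x 1 ≠ 0 ∧ ∀ j, j ≠ 1 → x j = 0)
    (hB1 : ∀ x, x ∈ B' i₁ ↔ x 2 ≠ 0 ∧ ∀ j, j ≠ 2 → x j = 0)
    (hC1 : ∀ x, x ∈ C' i₁ ↔ x 0 ≠ 0 ∧ ∀ j, j ≠ 0 → x j = 0)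
    (hne : ∀ i, (A' i).Nonempty ∧ (B' i).Nonempty ∧ (C' i).Nonempty) :
    Fintype.card ι ≤ 2 := by
  by_contra hlt
  rw [not_le] at hlt
  obtain ⟨i₂, hf⟩ := exists_third h01 hlt
  exact Prop52Maximal.prop52_pair_maximal (A := A' ∘ ![i₀, i₁, i₂]) (B := B' ∘ ![i₀, i₁, i₂])
    (C := C' ∘ ![i₀, i₁, i₂]) hn hA0 hB0 hC0 hA1 hB1 hC1 (hS.comp hf) (hne i₂)

/-- **Normalized form, case `rot²`** (`n ≥ 3`): the same with `(P₂,P₀,P₁)` at `i₁`; the coordinate rotation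
`x ↦ x ∘ (finRotate 3)⁻¹` (injective and additive, so the image family is STPP by
`addSimultaneousTPP_image_of_reflect`) sends `P_k` to `P_{k+1}`, i.e. the pair `(axes, rot²)` at `(i₀, i₁)`
to `(axes, rot)` at `(i₁, i₀)`. [cite: CohnKleinbergSzegedyUmans2005, Def. 5.1 and Prop. 5.2] -/
theorem card_le_two_of_axes_rot2 [Fintype ι] [DecidableEq ι] (hn : 3 ≤ n)
    (hS : AddSimultaneousTPP A' B' C') {i₀ i₁ : ι} (h01 : i₀ ≠ i₁)
    (hA0 : ∀ x, x ∈ A' i₀ ↔ x 0 ≠ 0 ∧ ∀ j, j ≠ 0 → x j = 0)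
    (hB0 : ∀ x, x ∈ B' i₀ ↔ x 1 ≠ 0 ∧ ∀ j, j ≠ 1 → x j = 0)
    (hC0 : ∀ x, x ∈ C' i₀ ↔ x 2 ≠ 0 ∧ ∀ j, j ≠ 2 → x j = 0)
    (hA1 : ∀ x, x ∈ A' i₁ ↔ x 2 ≠ 0 ∧ ∀ j, j ≠ 2 → x j = 0)
    (hB1 : ∀ x, x ∈ B' i₁ ↔ x 0 ≠ 0 ∧ ∀ j, j ≠ 0 → x j = 0)
    (hC1 : ∀ x, x ∈ C' i₁ ↔ x 1 ≠ 0 ∧ ∀ j, j ≠ 1 → x j = 0)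
    (hne : ∀ i, (A' i).Nonempty ∧ (B' i).Nonempty ∧ (C' i).Nonempty) :
    Fintype.card ι ≤ 2 := by
  set σ : Equiv.Perm (Fin 3) := (finRotate 3).symm with hσ
  have hσs : σ.symm = finRotate 3 := by rw [hσ, Equiv.symm_symm]
  have e0 : σ.symm 0 = 1 := by rw [hσs]; decide
  have e1 : σ.symm 1 = 2 := by rw [hσs]; decide
  have e2 : σ.symm 2 = 0 := by rw [hσs]; decide
  have hS' : AddSimultaneousTPP (fun i => (A' i).image fun x => x ∘ σ)
      (fun i => (B' i).image fun x => x ∘ σ) (fun i => (C' i).image fun x => x ∘ σ) :=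
    addSimultaneousTPP_image_of_reflect hS (fun x => x ∘ σ) fun a b c a' b' c' h => by
      funext i
      have := congr_fun h (σ.symm i)
      simpa using this
  have tr : ∀ (X : Finset (Fin 3 → ZMod n)) (k k' : Fin 3), σ.symm k = k' →
      (∀ x, x ∈ X ↔ x k ≠ 0 ∧ ∀ j, j ≠ k → x j = 0) →
        ∀ y, y ∈ X.image (fun x => x ∘ σ) ↔ y k' ≠ 0 ∧ ∀ j, j ≠ k' → y j = 0 := by
    intro X k k' hk hX y
    rw [mem_image_comp_equiv_iff σ hX y, hk]
  refine card_le_two_of_axes_rot hn hS' h01.symm (tr _ 2 0 e2 hA1) (tr _ 0 1 e0 hB1)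
    (tr _ 1 2 e1 hC1) (tr _ 0 1 e0 hA0) (tr _ 1 2 e1 hB0) (tr _ 2 0 e2 hC0) fun i => ?_
  exact ⟨(hne i).1.image _, (hne i).2.1.image _, (hne i).2.2.image _⟩

end Family

/-! ### Change of basis and the main theorem -/

section General

open scoped Matrix

variable {ι : Type} {A' B' C' : ι → Finset (Fin 3 → ZMod n)}

/-- Rows `M *ᵥ wₖ` form the matrix `W * Mᵀ` (`W` with rows `wₖ`). [folklore] -/
theorem of_mulVec_eq_mul_transpose (M : Matrix (Fin 3) (Fin 3) (ZMod n)) (w₀ w₁ w₂ : Fin 3 → ZMod n) :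
    Matrix.of ![M *ᵥ w₀, M *ᵥ w₁, M *ᵥ w₂] = Matrix.of ![w₀, w₁, w₂] * Mᵀ := by
  ext i j
  fin_cases i <;>
    simp [Matrix.mul_apply, Matrix.mulVec, dotProduct, Matrix.transpose_apply, Fin.sum_univ_three, mul_comm]

/-- The image of the non-zero multiples of `v` under `x ↦ M *ᵥ x` consists of the non-zero multiples of
`M *ᵥ v`. [folklore] -/
theorem mem_image_mulVec_iff (M : Matrix (Fin 3) (Fin 3) (ZMod n)) {X : Finset (Fin 3 → ZMod n)}
    {v : Fin 3 → ZMod n} (hX : ∀ x, x ∈ X ↔ ∃ c : ZMod n, c ≠ 0 ∧ x = c • v) (x : Fin 3 → ZMod n) :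
    x ∈ X.image (fun y => M *ᵥ y) ↔ ∃ c : ZMod n, c ≠ 0 ∧ x = c • (M *ᵥ v) := by
  constructor
  · intro hx
    obtain ⟨y, hy, rfl⟩ := Finset.mem_image.1 hx
    obtain ⟨c, hc, rfl⟩ := (hX y).1 hy
    exact ⟨c, hc, by rw [Matrix.mulVec_smul]⟩
  · rintro ⟨c, hc, rfl⟩
    exact Finset.mem_image.2 ⟨c • v, (hX _).2 ⟨c, hc, rfl⟩, by rw [Matrix.mulVec_smul]⟩

/-- **An STPP family with two frame triples has no third member** (`(ℤ/n)³`, every `n ≥ 4`; KILL memo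
T3 = T1 + T2).  If all triples of an STPP family consist of non-empty sets and two distinct members
`i₀ ≠ i₁` are frame triples (non-zero multiples of the columns of invertible matrices), then the family
has at most — hence exactly — two members.  Proof: the inverse frame matrix of `i₀` is an injective additive
map making `i₀` the axes triple and `i₁` a frame triple, which is `rot` or `rot²` by `member_is_rotation`;
conclude by `card_le_two_of_axes_rot(2)`.  Equivalently: an STPP family of `k ≥ 3` non-degenerate triples
contains at most one frame triple. [cite: CohnKleinbergSzegedyUmans2005, Def. 5.1 and Prop. 5.2] -/
theorem card_le_two_of_two_frames [Fintype ι] [DecidableEq ι] (hn : 4 ≤ n)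
    (hS : AddSimultaneousTPP A' B' C') {i₀ i₁ : ι} (h01 : i₀ ≠ i₁)
    (hframe : ∀ i, i = i₀ ∨ i = i₁ → ∃ v₀ v₁ v₂ : Fin 3 → ZMod n,
      IsUnit (Matrix.det (Matrix.of ![v₀, v₁, v₂])) ∧
      (∀ x, x ∈ A' i ↔ ∃ c : ZMod n, c ≠ 0 ∧ x = c • v₀) ∧
      (∀ x, x ∈ B' i ↔ ∃ c : ZMod n, c ≠ 0 ∧ x = c • v₁) ∧
      (∀ x, x ∈ C' i ↔ ∃ c : ZMod n, c ≠ 0 ∧ x = c • v₂))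
    (hne : ∀ i, (A' i).Nonempty ∧ (B' i).Nonempty ∧ (C' i).Nonempty) :
    Fintype.card ι ≤ 2 := by
  have hn3 : 3 ≤ n := le_trans (by norm_num) hn
  haveI : Fact (1 < n) := ⟨by omega⟩
  obtain ⟨v₀, v₁, v₂, hdet, hA, hB, hC⟩ := hframe i₀ (Or.inl rfl)
  obtain ⟨w₀, w₁, w₂, hdw, hAw, hBw, hCw⟩ := hframe i₁ (Or.inr rfl)
  -- change of basis: `N` has columns `v₀, v₁, v₂`; `M = N⁻¹` sends `vₖ ↦ eₖ`
  set N : Matrix (Fin 3) (Fin 3) (ZMod n) := (Matrix.of ![v₀, v₁, v₂])ᵀ with hN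
  have hNdet : IsUnit N.det := by rw [hN, Matrix.det_transpose]; exact hdet
  set M : Matrix (Fin 3) (Fin 3) (ZMod n) := N⁻¹ with hM
  have hMN : M * N = 1 := Matrix.nonsing_inv_mul N hNdet
  have hMdet : IsUnit M.det := by rw [hM]; exact (Matrix.isUnit_nonsing_inv_det_iff).2 hNdet
  have hMunit : IsUnit M := (Matrix.isUnit_iff_isUnit_det M).2 hMdet
  have hinj : Function.Injective (fun y : Fin 3 → ZMod n => M *ᵥ y) :=
    Matrix.mulVec_injective_of_isUnit hMunit
  have hcol : ∀ k : Fin 3, N *ᵥ Pi.single k 1 = ![v₀, v₁, v₂] k := by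
    intro k
    rw [Matrix.mulVec_single_one]
    funext i
    rw [Matrix.col_apply, hN, Matrix.transpose_apply, Matrix.of_apply]
  have hMv : ∀ k : Fin 3, M *ᵥ (![v₀, v₁, v₂] k) = Pi.single k 1 := by
    intro k
    rw [← hcol k, Matrix.mulVec_mulVec, hMN, Matrix.one_mulVec]
  -- the transported family
  have hS' : AddSimultaneousTPP (fun i => (A' i).image fun y => M *ᵥ y)
      (fun i => (B' i).image fun y => M *ᵥ y) (fun i => (C' i).image fun y => M *ᵥ y) :=
    addSimultaneousTPP_image_of_reflect hS (fun y => M *ᵥ y) fun a b c a' b' c' h =>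
      hinj (by simp only [Matrix.mulVec_add]; exact h)
  -- member `i₀` becomes the axes
  have ax : ∀ (k : Fin 3) (X : Finset (Fin 3 → ZMod n)) (v : Fin 3 → ZMod n), M *ᵥ v = Pi.single k 1 →
      (∀ x, x ∈ X ↔ ∃ c : ZMod n, c ≠ 0 ∧ x = c • v) →
        ∀ x, x ∈ X.image (fun y => M *ᵥ y) ↔ x k ≠ 0 ∧ ∀ j, j ≠ k → x j = 0 := by
    intro k X v hv hX x
    rw [mem_image_mulVec_iff M hX x, hv]
    exact mem_pline_axis_iff (by simp) (fun j hj => by simp [Pi.single_eq_of_ne hj]) x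
  have hA0 := ax 0 _ v₀ (hMv 0) hA
  have hB0 := ax 1 _ v₁ (hMv 1) hB
  have hC0 := ax 2 _ v₂ (hMv 2) hC
  -- member `i₁` stays a frame triple
  have hdw' : IsUnit (Matrix.det (Matrix.of ![M *ᵥ w₀, M *ᵥ w₁, M *ᵥ w₂])) := by
    rw [of_mulVec_eq_mul_transpose, Matrix.det_mul, Matrix.det_transpose]
    exact hdw.mul hMdet
  have hne' : ∀ i, ((A' i).image fun y => M *ᵥ y).Nonempty ∧ ((B' i).image fun y => M *ᵥ y).Nonempty ∧
      ((C' i).image fun y => M *ᵥ y).Nonempty :=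
    fun i => ⟨(hne i).1.image _, (hne i).2.1.image _, (hne i).2.2.image _⟩
  rcases member_is_rotation hn hS' h01 hA0 hB0 hC0 hdw' (mem_image_mulVec_iff M hAw)
      (mem_image_mulVec_iff M hBw) (mem_image_mulVec_iff M hCw) with ⟨a1, b1, c1⟩ | ⟨a1, b1, c1⟩
  · exact card_le_two_of_axes_rot hn3 hS' h01 hA0 hB0 hC0 a1 b1 c1 hne'
  · exact card_le_two_of_axes_rot2 hn3 hS' h01 hA0 hB0 hC0 a1 b1 c1 hne'

/-- **`k_max^{frame}(n) ≤ 2` for every modulus `n ≥ 4`**: an STPP family of frame triples in `(ℤ/n)³` has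
at most two members (attained by CKSU Prop. 5.2; the census clause K-F3(a) as a theorem, composite moduli
included).  Frame triples consist of non-empty sets (`1 • vₖ`, `1 ≠ 0`).
[cite: CohnKleinbergSzegedyUmans2005, Def. 5.1 and Prop. 5.2] -/
theorem card_le_two_of_frames [Fintype ι] [DecidableEq ι] (hn : 4 ≤ n)
    (hS : AddSimultaneousTPP A' B' C')
    (hframe : ∀ i, ∃ v₀ v₁ v₂ : Fin 3 → ZMod n, IsUnit (Matrix.det (Matrix.of ![v₀, v₁, v₂])) ∧
      (∀ x, x ∈ A' i ↔ ∃ c : ZMod n, c ≠ 0 ∧ x = c • v₀) ∧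
      (∀ x, x ∈ B' i ↔ ∃ c : ZMod n, c ≠ 0 ∧ x = c • v₁) ∧
      (∀ x, x ∈ C' i ↔ ∃ c : ZMod n, c ≠ 0 ∧ x = c • v₂)) :
    Fintype.card ι ≤ 2 := by
  have h1 : (1 : ZMod n) ≠ 0 := by
    have := natCast_ne_zero_of_lt (n := n) (k := 1) one_pos (by omega); simpa using this
  have hne : ∀ i, (A' i).Nonempty ∧ (B' i).Nonempty ∧ (C' i).Nonempty := by
    intro i
    obtain ⟨v₀, v₁, v₂, -, hA, hB, hC⟩ := hframe i
    exact ⟨⟨(1 : ZMod n) • v₀, (hA _).2 ⟨1, h1, rfl⟩⟩, ⟨(1 : ZMod n) • v₁, (hB _).2 ⟨1, h1, rfl⟩⟩,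
      ⟨(1 : ZMod n) • v₂, (hC _).2 ⟨1, h1, rfl⟩⟩⟩
  by_contra hlt
  rw [not_le] at hlt
  -- two distinct indices exist
  obtain ⟨i₀, i₁, h01⟩ : ∃ i₀ i₁ : ι, i₀ ≠ i₁ := by
    have : 1 < Fintype.card ι := by omega
    exact Fintype.exists_pair_of_one_lt_card this
  exact absurd (card_le_two_of_two_frames hn hS h01 (fun i _ => hframe i) hne) (by omega)

/-- **Prime-field form** (`𝔽_p³`, `p ≥ 5` prime, `det ≠ 0`): every STPP family of frame triples
`(L(v₀)∖0, L(v₁)∖0, L(v₂)∖0)` has at most two members — the unnormalized sequel of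
`FramePacking.frame_pair_classification` announced there. [cite: CohnKleinbergSzegedyUmans2005, Prop. 5.2] -/
theorem card_le_two_of_frames_prime {p : ℕ} [Fact p.Prime] [Fintype ι] [DecidableEq ι] (hp : 5 ≤ p)
    {A B C : ι → Finset (Fin 3 → ZMod p)} (hS : AddSimultaneousTPP A B C)
    (hframe : ∀ i, ∃ v₀ v₁ v₂ : Fin 3 → ZMod p, Matrix.det (Matrix.of ![v₀, v₁, v₂]) ≠ 0 ∧
      (∀ x, x ∈ A i ↔ ∃ c : ZMod p, c ≠ 0 ∧ x = c • v₀) ∧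
      (∀ x, x ∈ B i ↔ ∃ c : ZMod p, c ≠ 0 ∧ x = c • v₁) ∧
      (∀ x, x ∈ C i ↔ ∃ c : ZMod p, c ≠ 0 ∧ x = c • v₂)) :
    Fintype.card ι ≤ 2 :=
  card_le_two_of_frames (le_trans (by norm_num) hp) hS fun i => by
    obtain ⟨v₀, v₁, v₂, hd, h⟩ := hframe i
    exact ⟨v₀, v₁, v₂, isUnit_iff_ne_zero.2 hd, h⟩

end General

end FramePackingZMod

end Summit.MatrixMultiplication.MatrixMultiplication.Theorems
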